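import Literature.NumberTheory.DiophantineGeometry.GenEllDeProperness

/-!
# [GenEll] Thm 2.1 for `ℙ¹` (route piece W7-t, FAMILY version): properness of
# `t_c = 1/r + c·r^k/s` (`c ≠ 0`) on the cyclic cover `D_e : r^e = x(1 − x)`

Support lemma for the cell's number-field-only proof architecture of `GenEllTwo` (stmt-ABC-19679;
S. Mochizuki, *Arithmetic elliptic curves in general position*, Math. J. Okayama Univ. **52** (2010),
Thm. 2.1 (ii) ⇒ (i), proof p. 12; package map `GENELLTWO-P1ROUTE.md` of seat abc-iut-S6, W7
«properness», and S6 OWNER RULING #6 + AMENDMENT (2026-08-26): the primary route uses the FAMILY of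
Belyi-type functions `t_c := 1/r + c·r^{(e+1)/2}/(1 − 2x)`, `c ∈ ℚ^×`, on `D_e` («W7 (d031): per
(c, T)»)).

This file is the `c`-parametric twin of `GenEllDeProperness` (`c = 1`), for an arbitrary nonzero
`c` of the normed field `L`:

* `exists_norm_tc_ge_of_norm_x_ge` — near `Q_∞`, `t_c` is large: `‖x‖ ≥ R ⇒ T ≤ ‖t_c‖`
  (reduced to the `c = 1` growth lemma: `‖r^k/s‖ → ∞` while `‖1/r‖ ≤ 1`);
* `exists_lower_bound_tc_sub` — **W7-t for the family**: if the curve points of a domain `D` in any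
  `x`-window that are `ρ`-far from a set `Z ⊇ ⋃_{b ∈ B} t_c⁻¹(b)` form compact sets, ONE `ρ_t > 0`
  bounds `‖t_c − b‖` from below (`b ∈ B`) at every non-pole curve point of `D` that is `ρ`-far from
  `Z`.  The numerator of `t_c − b` is the polynomial `D_{c,b} = (1 − 2x) + c·r^{k+1} − b·r·(1 − 2x)`,
  which does not vanish at the poles on the affine curve (`r = 0 ⇒ D = ±1`; `1 − 2x = 0 ⇒
  D = c·r^{k+1} ≠ 0` as `c ≠ 0`).

Conventions as in `GenEllDeProperness`: `e = 2k − 1` is recorded as `2 * k = e + 1` (the cell's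
«D3» exponent `k' = k − 1`, `t_c = ((1−2x) + c·r^{k'+2})/(r(1−2x))`, is the same function off the
poles).  No definitions (proof-only).  Classical and undisputed; nothing here bears on
[IUTchIII] Cor. 3.12.
-/

namespace Literature.NumberTheory.DiophantineGeometry.GenEll

open Metric Set

section Engine

variable {X E : Type*} [TopologicalSpace X] [NormedAddCommGroup E]

/-- On a compact set, a continuous function that does not vanish is bounded below in norm by a
positive constant. [folklore] -/
private theorem exists_pos_le_norm_of_compact' {S : Set X} (hS : IsCompact S) {f : X → E}
    (hf : ContinuousOn f S) (hne : ∀ P ∈ S, f P ≠ 0) :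
    ∃ m : ℝ, 0 < m ∧ ∀ P ∈ S, m ≤ ‖f P‖ := by
  rcases S.eq_empty_or_nonempty with rfl | hSne
  · exact ⟨1, one_pos, fun P hP => hP.elim⟩
  obtain ⟨P₀, hP₀, hmin⟩ := hS.exists_isMinOn hSne (hf.norm)
  exact ⟨‖f P₀‖, norm_pos_iff.mpr (hne P₀ hP₀), fun P hP => hmin hP⟩

end Engine

section CurveFar

variable {L : Type*} [NormedField L]

/-- `‖1 − 2x‖ ≤ 1 + 2‖x‖`. [folklore] -/
private theorem norm_one_sub_two_mul_le' (x : L) : ‖1 - 2 * x‖ ≤ 1 + 2 * ‖x‖ := by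
  calc ‖1 - 2 * x‖ ≤ ‖(1 : L)‖ + ‖2 * x‖ := norm_sub_le _ _
    _ ≤ 1 + 2 * ‖x‖ := by
        rw [norm_one]
        gcongr
        calc ‖2 * x‖ = ‖x + x‖ := by rw [two_mul]
          _ ≤ ‖x‖ + ‖x‖ := norm_add_le x x
          _ = 2 * ‖x‖ := by ring

/-- On the curve `r^e = x(1−x)` (`e ≥ 1`), `‖x‖ ≤ R` bounds `‖r‖ ≤ max 1 (R(1+R))`. [folklore] -/
private theorem norm_r_le_of_norm_x_le' {e : ℕ} (he : 0 < e) {x r : L}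
    (hcurve : r ^ e = x * (1 - x)) {R : ℝ} (hx : ‖x‖ ≤ R) : ‖r‖ ≤ max 1 (R * (1 + R)) := by
  by_cases hr : ‖r‖ ≤ 1
  · exact hr.trans (le_max_left _ _)
  · have hr1 : 1 < ‖r‖ := lt_of_not_ge hr
    have hre : ‖r‖ ≤ ‖r‖ ^ e := le_self_pow₀ hr1.le he.ne'
    have : ‖r‖ ^ e = ‖x‖ * ‖1 - x‖ := by rw [← norm_pow, hcurve, norm_mul]
    have h1x : ‖1 - x‖ ≤ 1 + R := (norm_sub_le 1 x).trans (by simp [hx])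
    have hR : 0 ≤ R := (norm_nonneg x).trans hx
    calc ‖r‖ ≤ ‖r‖ ^ e := hre
      _ = ‖x‖ * ‖1 - x‖ := this
      _ ≤ R * (1 + R) := mul_le_mul hx h1x (norm_nonneg _) hR
      _ ≤ max 1 (R * (1 + R)) := le_max_right _ _

/-- On the curve, `‖x‖ ≤ R` bounds `‖r · (1 − 2x)‖ ≤ max 1 (R(1+R)) · (1 + 2R)`. [folklore] -/
private theorem norm_r_mul_s_le' {e : ℕ} (he : 0 < e) {x r : L} (hcurve : r ^ e = x * (1 - x))
    {R : ℝ} (hx : ‖x‖ ≤ R) : ‖r * (1 - 2 * x)‖ ≤ max 1 (R * (1 + R)) * (1 + 2 * R) := by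
  rw [norm_mul]
  have hR : 0 ≤ R := (norm_nonneg x).trans hx
  exact mul_le_mul (norm_r_le_of_norm_x_le' he hcurve hx)
    ((norm_one_sub_two_mul_le' x).trans (by linarith)) (norm_nonneg _)
    (zero_le_one.trans (le_max_left _ _))

/-- Away from the poles: `t_c − b = D_{c,b} / (r·(1−2x))` with the POLYNOMIAL numerator
`D_{c,b} = (1 − 2x) + c·r^{k+1} − b·r·(1 − 2x)`. [folklore] -/
private theorem tc_sub_eq_div {x r : L} (hr : r ≠ 0) (hs : 1 - 2 * x ≠ 0) (c : L) (k : ℕ)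
    (b : L) :
    r⁻¹ + c * r ^ k / (1 - 2 * x) - b =
      ((1 - 2 * x) + c * r ^ (k + 1) - b * r * (1 - 2 * x)) / (r * (1 - 2 * x)) := by
  field_simp
  ring

/-- The numerator `D_{c,b}` (`c ≠ 0`) does NOT vanish at the poles lying on the affine curve: if
`r^e = x(1−x)` and `r = 0` then `x ∈ {0,1}` and `D = 1 − 2x = ±1`; if `1 − 2x = 0` then
`D = c·r^{k+1}` with `r ≠ 0`. Hence a zero of `D_{c,b}` on the curve lies in the fibre `t_c⁻¹(b)`.
[folklore] -/
private theorem tc_eq_of_numerator_eq_zero {e : ℕ} (he : 0 < e) {x r : L}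
    (hcurve : r ^ e = x * (1 - x)) {c : L} (hc : c ≠ 0) {k : ℕ} {b : L}
    (hD : (1 - 2 * x) + c * r ^ (k + 1) - b * r * (1 - 2 * x) = 0) :
    r ≠ 0 ∧ 1 - 2 * x ≠ 0 ∧ r⁻¹ + c * r ^ k / (1 - 2 * x) = b := by
  have hr : r ≠ 0 := by
    rintro rfl
    rw [zero_pow he.ne'] at hcurve
    have hx : x = 0 ∨ x = 1 := by
      rcases mul_eq_zero.mp hcurve.symm with h | h
      · exact Or.inl h
      · exact Or.inr (by linear_combination -h)
    rw [zero_pow (Nat.succ_ne_zero k), mul_zero, mul_zero, zero_mul, sub_zero, add_zero] at hD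
    rcases hx with rfl | rfl
    · simp at hD
    · norm_num at hD
  have hs : 1 - 2 * x ≠ 0 := by
    intro hs
    rw [hs, mul_zero, sub_zero, zero_add] at hD
    exact (mul_ne_zero hc (pow_ne_zero _ hr)) hD
  refine ⟨hr, hs, ?_⟩
  have h := tc_sub_eq_div hr hs c k b
  rw [hD, zero_div, sub_eq_zero] at h
  exact h

/-- **Near `Q_∞`, `t_c` is large** (`c ≠ 0`): for every `T` there is `R` such that every curve point
`r^e = x(1−x)` (`2k = e + 1`) with `‖x‖ ≥ R`, `1 − 2x ≠ 0`, has `T ≤ ‖t_c‖`,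
`t_c = r⁻¹ + c·r^k/(1 − 2x)`.  (From the `c = 1` case: there `‖r^k/(1−2x)‖ ≥ T₁ − 1` while
`‖r⁻¹‖ ≤ 1`, so `‖t_c‖ ≥ ‖c‖(T₁ − 1) − 1`.) [cite: MochizukiGenEll2010, Thm 2.1 p.12] -/
theorem exists_norm_tc_ge_of_norm_x_ge {e k : ℕ} (he : 0 < e) (hk : 2 * k = e + 1) {c : L}
    (hc : c ≠ 0) (T : ℝ) :
    ∃ R : ℝ, 0 < R ∧ ∀ x r : L, r ^ e = x * (1 - x) → 1 - 2 * x ≠ 0 → R ≤ ‖x‖ →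
      T ≤ ‖r⁻¹ + c * r ^ k / (1 - 2 * x)‖ := by
  have hc0 : 0 < ‖c‖ := norm_pos_iff.mpr hc
  obtain ⟨R₁, hR₁0, hR₁⟩ :=
    exists_norm_t_ge_of_norm_x_ge (L := L) he hk ((T + 1) / ‖c‖ + 2)
  refine ⟨max 2 R₁, lt_max_of_lt_right hR₁0, fun x r hcurve hs hx => ?_⟩
  have hx2 : 2 ≤ ‖x‖ := (le_max_left _ _).trans hx
  have hxR : R₁ ≤ ‖x‖ := (le_max_right _ _).trans hx
  -- ‖r‖ ≥ 1, so ‖r⁻¹‖ ≤ 1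
  have hre : ‖r‖ ^ e = ‖x‖ * ‖1 - x‖ := by rw [← norm_pow, hcurve, norm_mul]
  have h1x : 1 ≤ ‖1 - x‖ := by
    have := norm_sub_norm_le x 1
    rw [norm_one, ← norm_neg (x - 1), neg_sub] at this
    linarith
  have hr1 : 1 ≤ ‖r‖ := by
    by_contra h
    have h' : ‖r‖ < 1 := lt_of_not_ge h
    have : ‖r‖ ^ e < 1 := pow_lt_one₀ (norm_nonneg r) h' he.ne'
    rw [hre] at this
    nlinarith
  have hinv : ‖r⁻¹‖ ≤ 1 := by
    rw [norm_inv]; exact inv_le_one_of_one_le₀ hr1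
  -- from the c = 1 lemma: ‖r^k/s‖ ≥ (T+1)/‖c‖ + 1
  have h1 := hR₁ x r hcurve hs hxR
  have hq : (T + 1) / ‖c‖ + 1 ≤ ‖r ^ k / (1 - 2 * x)‖ := by
    have := norm_add_le r⁻¹ (r ^ k / (1 - 2 * x))
    linarith
  -- hence ‖c · r^k/s‖ ≥ T + 1 + ‖c‖
  have hcq : T + 1 + ‖c‖ ≤ ‖c * r ^ k / (1 - 2 * x)‖ := by
    rw [mul_div_assoc, norm_mul]
    have := mul_le_mul_of_nonneg_left hq hc0.le
    rw [mul_add, mul_one, mul_div_cancel₀ _ hc0.ne'] at this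
    exact this
  have := norm_sub_norm_le (c * r ^ k / (1 - 2 * x)) (-r⁻¹)
  rw [norm_neg, sub_neg_eq_add, add_comm] at this
  linarith

/-- Finite minimum of positive witnesses (antitone properties). [folklore] -/
private theorem exists_pos_forall_of_antitone_fam {α : Type*} (B : Finset α) (Q : α → ℝ → Prop)
    (hmono : ∀ b m m', 0 < m' → m' ≤ m → Q b m → Q b m')
    (h : ∀ b ∈ B, ∃ m : ℝ, 0 < m ∧ Q b m) : ∃ m : ℝ, 0 < m ∧ ∀ b ∈ B, Q b m := by
  classical
  induction B using Finset.induction_on with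
  | empty => exact ⟨1, one_pos, by simp⟩
  | insert a B ha ih =>
    obtain ⟨m₁, hm₁, hQ₁⟩ := h a (Finset.mem_insert_self a B)
    obtain ⟨m₂, hm₂, hQ₂⟩ := ih fun b hb => h b (Finset.mem_insert_of_mem hb)
    refine ⟨min m₁ m₂, lt_min hm₁ hm₂, fun b hb => ?_⟩
    rcases Finset.mem_insert.mp hb with rfl | hb
    · exact hmono _ _ _ (lt_min hm₁ hm₂) (min_le_left _ _) hQ₁
    · exact hmono _ _ _ (lt_min hm₁ hm₂) (min_le_right _ _) (hQ₂ b hb)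

/-- **W7-t for the family `t_c`** (`c ≠ 0`).  Let `2k = e + 1`, `B ⊆ L` finite, and `Z ⊆ L × L` a
set containing every point of every fibre `t_c⁻¹(b)`, `b ∈ B`, of `t_c = r⁻¹ + c·r^k/(1 − 2x)` on
the affine curve `r^e = x(1−x)` minus its poles.  Let `D ⊆ L × L` be a point-domain such that, for
every `R`, the curve points of `D` with `‖x‖ ≤ R` that are `ρ`-far from `Z` form a compact set
(`isCompact_curveFar_of_properSpace` / `_of_submodule`).  Then ONE `ρ_t > 0` satisfies
`ρ_t ≤ ‖t_c − b‖` for all `b ∈ B` at every non-pole curve point of `D` that is `ρ`-far from `Z`.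
[cite: MochizukiGenEll2010, Thm 2.1 p.12] -/
theorem exists_lower_bound_tc_sub {e k : ℕ} (he : 0 < e) (hk : 2 * k = e + 1) {c : L}
    (hc : c ≠ 0) (B : Finset L) (Z : Set (L × L))
    (hZ : ∀ b ∈ B, ∀ P : L × L, P.2 ^ e = P.1 * (1 - P.1) → P.2 ≠ 0 → 1 - 2 * P.1 ≠ 0 →
      P.2⁻¹ + c * P.2 ^ k / (1 - 2 * P.1) = b → P ∈ Z)
    {ρ : ℝ} (hρ : 0 < ρ) (D : Set (L × L))
    (hD : ∀ R : ℝ, IsCompact {P : L × L | P ∈ D ∧ P.2 ^ e = P.1 * (1 - P.1) ∧ ‖P.1‖ ≤ R ∧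
      ∀ z ∈ Z, ρ ≤ dist P z}) :
    ∃ ρt : ℝ, 0 < ρt ∧ ∀ P ∈ D, P.2 ^ e = P.1 * (1 - P.1) → P.2 ≠ 0 → 1 - 2 * P.1 ≠ 0 →
      (∀ z ∈ Z, ρ ≤ dist P z) → ∀ b ∈ B, ρt ≤ ‖P.2⁻¹ + c * P.2 ^ k / (1 - 2 * P.1) - b‖ := by
  set M : ℝ := ∑ b ∈ B, ‖b‖ with hM
  have hMb : ∀ b ∈ B, ‖b‖ ≤ M := fun b hb =>
    Finset.single_le_sum (f := fun b => ‖b‖) (fun _ _ => norm_nonneg _) hb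
  obtain ⟨R, hR0, hRt⟩ := exists_norm_tc_ge_of_norm_x_ge (L := L) he hk hc (M + 1)
  set C : ℝ := max 1 (R * (1 + R)) * (1 + 2 * R) with hC
  have hC0 : 0 < C := by positivity
  set S : Set (L × L) := {P : L × L | P ∈ D ∧ P.2 ^ e = P.1 * (1 - P.1) ∧ ‖P.1‖ ≤ R ∧
    ∀ z ∈ Z, ρ ≤ dist P z} with hS
  have hScpt : IsCompact S := hD R
  have hper : ∀ b ∈ B, ∃ m : ℝ, 0 < m ∧ ∀ P ∈ S,
      m ≤ ‖(1 - 2 * P.1) + c * P.2 ^ (k + 1) - b * P.2 * (1 - 2 * P.1)‖ := by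
    intro b hb
    refine exists_pos_le_norm_of_compact' hScpt (by fun_prop) ?_
    rintro P ⟨-, hcurve, -, hfar⟩ hD0
    obtain ⟨hr, hs, ht⟩ := tc_eq_of_numerator_eq_zero he hcurve hc hD0
    have hPZ : P ∈ Z := hZ b hb P hcurve hr hs ht
    have := hfar P hPZ
    rw [dist_self] at this
    exact absurd this (not_le.mpr hρ)
  obtain ⟨m, hm0, hm⟩ := exists_pos_forall_of_antitone_fam B
    (fun b m => ∀ P ∈ S, m ≤ ‖(1 - 2 * P.1) + c * P.2 ^ (k + 1) - b * P.2 * (1 - 2 * P.1)‖)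
    (fun b m m' _ hle h P hP => hle.trans (h P hP)) hper
  refine ⟨min 1 (m / C), lt_min one_pos (div_pos hm0 hC0), ?_⟩
  rintro ⟨x, r⟩ hPD hcurve hr hs hfar b hb
  dsimp only at hcurve hr hs ⊢
  by_cases hxR : ‖x‖ ≤ R
  · have hmem : ((x, r) : L × L) ∈ S := ⟨hPD, hcurve, hxR, hfar⟩
    have hDb : m ≤ ‖(1 - 2 * x) + c * r ^ (k + 1) - b * r * (1 - 2 * x)‖ := hm b hb (x, r) hmem
    have hrs : ‖r * (1 - 2 * x)‖ ≤ C := norm_r_mul_s_le' he hcurve hxR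
    have hrs0 : 0 < ‖r * (1 - 2 * x)‖ := norm_pos_iff.mpr (mul_ne_zero hr hs)
    rw [tc_sub_eq_div hr hs c k b, norm_div]
    calc min 1 (m / C) ≤ m / C := min_le_right _ _
      _ ≤ m / ‖r * (1 - 2 * x)‖ := div_le_div_of_nonneg_left hm0.le hrs0 hrs
      _ ≤ ‖(1 - 2 * x) + c * r ^ (k + 1) - b * r * (1 - 2 * x)‖ / ‖r * (1 - 2 * x)‖ :=
          div_le_div_of_nonneg_right hDb hrs0.le
  · have hxR' : R ≤ ‖x‖ := (lt_of_not_ge hxR).le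
    have ht : M + 1 ≤ ‖r⁻¹ + c * r ^ k / (1 - 2 * x)‖ := hRt x r hcurve hs hxR'
    have h1 : ‖r⁻¹ + c * r ^ k / (1 - 2 * x)‖ - ‖b‖ ≤ ‖r⁻¹ + c * r ^ k / (1 - 2 * x) - b‖ :=
      norm_sub_norm_le _ _
    have h2 := hMb b hb
    calc min 1 (m / C) ≤ 1 := min_le_left _ _
      _ ≤ ‖r⁻¹ + c * r ^ k / (1 - 2 * x) - b‖ := by linarith

end CurveFar

end Literature.NumberTheory.DiophantineGeometry.GenEll
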